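import Summits.BirchSwinnertonDyer.BirchSwinnertonDyer.Theorems.AlignedTransportAtTwoMainConjectureOfRankZeroBSDAtTwoHalfDescentLayerIndexSelmer
import HarnessLib

/-!
# Route `AlignedTransportAtTwo`, crux C2 `MainConjectureOfRankZeroBSDAtTwo` (stmt-BirchSwinnertonDyer-22298):
# THE LAYER-GROWTH NUMBER IS AN INDEX, VIII — FINITE LEVEL: with Greenberg's Lemma 4.3 at every layer (tree, unconditional `Nat.card` identity
# `#Sel_∞^{Γ_n}·#ker h_n = #Sel_{p^∞}(E/K_n)·#ker g_n`) the layer index becomes an identity between ACTUAL Selmer orders over `K_n`, `K_{n+1}` and the control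
# kernels: `#Sel_{n+1}·#ker g_{n+1}·#ker h_n = #Sel_n·#ker g_n·#ker h_{n+1}·#ker N_n`, `#ker N_n = p^{φ(p^{n+1})μ + λ}` at high layers; and Iwasawa's formula for
# `#Sel_{p^∞}(E/K_n)` EXACT from the first high layer modulo the displayed kernels

HONEST FRAMING (cell `bsd-f1-sign2`, WIDTH-5 attached prover seat `bsd-line-att-p5` gen 54 on line `birth` of the lead `bsd-line-att-p2`;
`--supports` stmt-BirchSwinnertonDyer-22298, closes nothing; BSD is NOT proved by any of this; the crux C2, its verdict «blocked-on
`Rank1Residual.GreenbergMuConjectureIrreducible`» and every registered stub (P / T / Kμ / LimDoor / MuIneqʳ / PFμ⁺) are untouched). THEOREMS ONLY — no `def`,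
no instance, no named fact, no `sorry`; «`X` has no non-zero finite submodule» is the DISPLAYED hypothesis `hnf`. Sequel of `…HalfDescentLayerIndexSelmer`
(this gen: `#(X/ω_nX) = #Sel_∞^{Γ_n}`, `#(X/Ψ_nX) = #ker N_n = p^{pⁿ(p−1)μ+λ}`, `#Sel_∞^{Γ_{n+1}} = #Sel_∞^{Γ_n}·#ker N_n`, Iwasawa exact for `#Sel_∞^{Γ_n}`)
composed with the tree's Lemma 4.3 `WeierstrassCurve.natCard_selmerInvariants_mul_natCard_ker_layerToInfty` (`h_n : H¹(K_n) → H¹(K_∞)`, `ker g_n = A_n/Sel_n`,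
`IwasawaSelmerControlExactCountProofs`) and its fixed-point form `natCard_selmerInvariants_mul_natCard_fixedPoints` (`#ker h_n = #E[p^∞]^{Gal(K̄/K_n)}` when
`E(K_∞)[p^∞]` is finite). NOTHING is cancelled: all statements are products of `Nat.card`s (valid verbatim when a factor is infinite, i.e. `0`).

* ★★ `natCard_selmerLayer_succ_mul_eq`: `f(0) ≠ 0`, `Ψ_m ∤ f` (`m < n`) ⟹ **`#Sel_{n+1}·#ker g_{n+1}·#ker h_n = #Sel_n·#ker g_n·#ker h_{n+1}·#ker N_n`**, and with
  `λ(f) < pⁿ(p−1)`: `… = #Sel_n·#ker g_n·#ker h_{n+1}·p^{pⁿ(p−1)μ(f)+λ(f)}` — ONE RELATIVE DESCENT (`K_n → K_{n+1}`) reads the layer-growth number, given the two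
  control kernels (finite by Greenberg's Lemma 3.3 at the places above `p`, g40 `…SelmerLayerControlLocal`) and the torsion kernels `ker h`.
* ★★★ `natCard_selmerLayer_mul_pow_eq`: for `n ≥ n₀` (first high layer; `f` coprime to `ω_{n₀}`):
  **`#Sel_n·#ker g_n·#ker h_{n₀}·p^{μp^{n₀}+λn₀} = #Sel_{n₀}·#ker g_{n₀}·#ker h_n·p^{μpⁿ+λn}`** — Iwasawa's `e_n = μpⁿ + λn + ν` for `#Sel_{p^∞}(E/K_n)`, exact
  modulo the displayed kernels; `…_fixedPoints` forms with `#E[p^∞]^{Gal(K̄/K_n)}` in place of `#ker h_n` when `E(K_∞)[p^∞]` is finite.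
Reading for C2 (`p = 2`, `W/ℚ`, cyclotomic tower, `E(ℚ_∞)[2] = 0` seeds so that all `ker h_n` are trivial): the descent number `#ker N_n` is
`(#Sel_{2^∞}(W/ℚ_{n+1})·#ker g_{n+1}) / (#Sel_{2^∞}(W/ℚ_n)·#ker g_n)`. Memo `Cruxes/MainConjectureOfRankZeroBSDAtTwo/LAYER-INDEX-att-p5-g54.md`.
BSD is not proved by any of this; nothing about any curve is asserted here.

References: R. Greenberg, LNM 1716 (1999), §3 Lemmas 3.1–3.3, §4 Lemma 4.3 (p. 103), Thm. 1.10 [GreenbergLNM1716]; L. Washington, GTM 83, §13.3 Thm. 13.13 [Washington1997];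
B. Mazur, Invent. Math. 18 (1972) (control) [Mazur1972].
-/

set_option linter.dupNamespace false
set_option autoImplicit false

noncomputable section

open scoped Classical AddSubgroup Polynomial

universe u

namespace Summit.BirchSwinnertonDyer.BirchSwinnertonDyer.Theorems.AlignedTransportAtTwoHalfDescentLayerIndexControl

open WeierstrassCurve Literature.NumberTheory.EllipticCurves Literature.NumberTheory.EllipticCurves.IwasawaDual
  Literature.NumberTheory.EllipticCurves.IwasawaAlgebra
  Summit.BirchSwinnertonDyer.Rank1Residual.X1.MuLambda
  Summit.BirchSwinnertonDyer.Rank1Residual.Iwasawa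
  Summit.BirchSwinnertonDyer.BirchSwinnertonDyer.Theorems.AlignedTransportAtTwoHalfDescentLayerIndexSelmer

variable {K : Type u} [Field K] [NumberField K] (W : WeierstrassCurve K) {p : ℕ} [hp : Fact p.Prime] (κ : ZpExtension K p)
  {γ : Field.absoluteGaloisGroup K}

/-- ★★ **ONE RELATIVE DESCENT READS THE LAYER INDEX.** `E/K`, `κ` any `ℤ_p`-extension with topological generator `γ`, dual datum `D` with `X` f.g. torsion WITHOUT
non-zero finite submodule, `char_Λ X = (f)`, `f(0) ≠ 0`, `Ψ_m ∤ f` for `m < n`. Then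
**`#Sel_{p^∞}(E/K_{n+1}) · #ker g_{n+1} · #ker h_n = #Sel_{p^∞}(E/K_n) · #ker g_n · #ker h_{n+1} · #ker(N_n | Sel_∞)`**, and if moreover `λ(f) < pⁿ(p−1)` the last
factor is `p^{pⁿ(p−1)·μ(f) + λ(f)}` (`h_m : H¹(K_m, E[p^∞]) → H¹(K_∞, E[p^∞])`, `ker g_m = A_m/Sel_m` Greenberg's control kernel).
[cite: GreenbergLNM1716, §4 Lemma 4.3 (p. 103) and §3 p. 85] [cite: Washington1997, §13.3 Thm. 13.13] -/
theorem natCard_selmerLayer_succ_mul_eq (hγ : κ.IsTopGenerator γ) (D : W.SelmerDualData κ γ) [Module.Finite (IwasawaAlgebra p) D.X]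
    (hD : D.IsTorsion) (hnf : ∀ N' : Submodule (IwasawaAlgebra p) D.X, Finite N' → N' = ⊥) {f : IwasawaAlgebra p}
    (hchar : D.charIdeal = Ideal.span {f}) (h0 : PowerSeries.constantCoeff f ≠ 0) {n : ℕ}
    (hΨ : ∀ m < n, ¬ ((((Polynomial.cyclotomic (p ^ (m + 1)) ℤ_[p]).comp (Polynomial.X + 1) : ℤ_[p][X]) : IwasawaAlgebra p) ∣ f)) :
    Nat.card ↥(W.selmerLayer κ (n + 1)) * Nat.card (W.KerG κ (n + 1)) * Nat.card (W.layerToInfty κ n).ker =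
      Nat.card ↥(W.selmerLayer κ n) * Nat.card (W.KerG κ n) * Nat.card (W.layerToInfty κ (n + 1)).ker *
        Nat.card ↥(endInvariants (∑ i ∈ Finset.range p, ((W.conjSelmerInfty κ γ) ^ (p ^ n)) ^ i)) ∧
    (lam f < p ^ n * (p - 1) →
      Nat.card ↥(W.selmerLayer κ (n + 1)) * Nat.card (W.KerG κ (n + 1)) * Nat.card (W.layerToInfty κ n).ker =
        Nat.card ↥(W.selmerLayer κ n) * Nat.card (W.KerG κ n) * Nat.card (W.layerToInfty κ (n + 1)).ker * p ^ (p ^ n * (p - 1) * mu f + lam f)) := by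
  have h43 := W.natCard_selmerInvariants_mul_natCard_ker_layerToInfty κ n
  have h43' := W.natCard_selmerInvariants_mul_natCard_ker_layerToInfty κ (n + 1)
  obtain ⟨hstep, hpow⟩ := natCard_selmerInvariants_succ_eq_mul W κ hγ D hD hnf hchar h0 hΨ
  have key : Nat.card ↥(W.selmerLayer κ (n + 1)) * Nat.card (W.KerG κ (n + 1)) * Nat.card (W.layerToInfty κ n).ker =
      Nat.card ↥(W.selmerLayer κ n) * Nat.card (W.KerG κ n) * Nat.card (W.layerToInfty κ (n + 1)).ker *
        Nat.card ↥(endInvariants (∑ i ∈ Finset.range p, ((W.conjSelmerInfty κ γ) ^ (p ^ n)) ^ i)) := by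
    calc Nat.card ↥(W.selmerLayer κ (n + 1)) * Nat.card (W.KerG κ (n + 1)) * Nat.card (W.layerToInfty κ n).ker
        = (Nat.card ↥(W.selmerInfty κ ⊓ W.layerInvariants κ (n + 1)) * Nat.card (W.layerToInfty κ (n + 1)).ker) *
            Nat.card (W.layerToInfty κ n).ker := by rw [h43']
      _ = (Nat.card ↥(W.selmerInfty κ ⊓ W.layerInvariants κ n) * Nat.card (W.layerToInfty κ n).ker) *
            Nat.card (W.layerToInfty κ (n + 1)).ker *
              Nat.card ↥(endInvariants (∑ i ∈ Finset.range p, ((W.conjSelmerInfty κ γ) ^ (p ^ n)) ^ i)) := by rw [hstep]; ring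
      _ = _ := by rw [h43]
  exact ⟨key, fun hlam ↦ by rw [key, natCard_endInvariants_relNorm_eq_pow W κ hγ D hD hnf hchar hlam]⟩

/-- ★★★ **IWASAWA'S THEOREM FOR `#Sel_{p^∞}(E/K_n)`, EXACT MODULO THE DISPLAYED KERNELS.** Same setting, `f(0) ≠ 0`, `Ψ_m ∤ f` for `m < n₀`, `λ(f) < p^{n₀}(p−1)`;
for every `n ≥ n₀`: **`#Sel_n · #ker g_n · #ker h_{n₀} · p^{μ(f)p^{n₀} + λ(f)n₀} = #Sel_{n₀} · #ker g_{n₀} · #ker h_n · p^{μ(f)pⁿ + λ(f)n}`**.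
[cite: GreenbergLNM1716, §4 Lemma 4.3 (p. 103), Thm. 1.10] [cite: Washington1997, §13.3 Thm. 13.13] -/
theorem natCard_selmerLayer_mul_pow_eq (hγ : κ.IsTopGenerator γ) (D : W.SelmerDualData κ γ) [Module.Finite (IwasawaAlgebra p) D.X]
    (hD : D.IsTorsion) (hnf : ∀ N' : Submodule (IwasawaAlgebra p) D.X, Finite N' → N' = ⊥) {f : IwasawaAlgebra p}
    (hchar : D.charIdeal = Ideal.span {f}) (h0 : PowerSeries.constantCoeff f ≠ 0) {n₀ : ℕ}
    (hΨ : ∀ m < n₀, ¬ ((((Polynomial.cyclotomic (p ^ (m + 1)) ℤ_[p]).comp (Polynomial.X + 1) : ℤ_[p][X]) : IwasawaAlgebra p) ∣ f))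
    (hlam : lam f < p ^ n₀ * (p - 1)) {n : ℕ} (hn : n₀ ≤ n) :
    Nat.card ↥(W.selmerLayer κ n) * Nat.card (W.KerG κ n) * Nat.card (W.layerToInfty κ n₀).ker * p ^ (mu f * p ^ n₀ + lam f * n₀) =
      Nat.card ↥(W.selmerLayer κ n₀) * Nat.card (W.KerG κ n₀) * Nat.card (W.layerToInfty κ n).ker * p ^ (mu f * p ^ n + lam f * n) := by
  have h43 := W.natCard_selmerInvariants_mul_natCard_ker_layerToInfty κ n
  have h43₀ := W.natCard_selmerInvariants_mul_natCard_ker_layerToInfty κ n₀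
  have hmain := natCard_selmerInvariants_mul_pow_eq W κ hγ D hD hnf hchar h0 hΨ hlam hn
  calc Nat.card ↥(W.selmerLayer κ n) * Nat.card (W.KerG κ n) * Nat.card (W.layerToInfty κ n₀).ker * p ^ (mu f * p ^ n₀ + lam f * n₀)
      = (Nat.card ↥(W.selmerInfty κ ⊓ W.layerInvariants κ n) * p ^ (mu f * p ^ n₀ + lam f * n₀)) *
          Nat.card (W.layerToInfty κ n).ker * Nat.card (W.layerToInfty κ n₀).ker := by rw [← h43]; ring
    _ = (Nat.card ↥(W.selmerInfty κ ⊓ W.layerInvariants κ n₀) * Nat.card (W.layerToInfty κ n₀).ker) *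
          Nat.card (W.layerToInfty κ n).ker * p ^ (mu f * p ^ n + lam f * n) := by rw [hmain]; ring
    _ = _ := by rw [h43₀]

/-- The same two statements with **`#ker h_m = #E[p^∞]^{Gal(K̄/K_m)}`** substituted, when `E(K_∞)[p^∞]` is finite (tree `natCard_selmerInvariants_mul_natCard_fixedPoints`):
the one-step law **`#Sel_{n+1}·#ker g_{n+1}·#E[p^∞]^{G_{K_n}} = #Sel_n·#ker g_n·#E[p^∞]^{G_{K_{n+1}}}·p^{pⁿ(p−1)μ(f)+λ(f)}`** at a high layer, and Iwasawa's formula.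
[cite: GreenbergLNM1716, §4 Lemma 4.3 (p. 103)] [cite: Washington1997, §13.3 Thm. 13.13] -/
theorem natCard_selmerLayer_mul_pow_eq_fixedPoints (hγ : κ.IsTopGenerator γ) (D : W.SelmerDualData κ γ) [Module.Finite (IwasawaAlgebra p) D.X]
    [Finite (FixedPoints.addSubgroup κ.kerSubgroup (geomPrimaryTorsion W p))]
    (hD : D.IsTorsion) (hnf : ∀ N' : Submodule (IwasawaAlgebra p) D.X, Finite N' → N' = ⊥) {f : IwasawaAlgebra p}
    (hchar : D.charIdeal = Ideal.span {f}) (h0 : PowerSeries.constantCoeff f ≠ 0) {n₀ : ℕ}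
    (hΨ : ∀ m < n₀, ¬ ((((Polynomial.cyclotomic (p ^ (m + 1)) ℤ_[p]).comp (Polynomial.X + 1) : ℤ_[p][X]) : IwasawaAlgebra p) ∣ f))
    (hlam : lam f < p ^ n₀ * (p - 1)) :
    (Nat.card ↥(W.selmerLayer κ (n₀ + 1)) * Nat.card (W.KerG κ (n₀ + 1)) *
        Nat.card {m : geomPrimaryTorsion W p | ∀ σ ∈ κ.layerSubgroup n₀, σ • m = m} =
      Nat.card ↥(W.selmerLayer κ n₀) * Nat.card (W.KerG κ n₀) *
        Nat.card {m : geomPrimaryTorsion W p | ∀ σ ∈ κ.layerSubgroup (n₀ + 1), σ • m = m} * p ^ (p ^ n₀ * (p - 1) * mu f + lam f)) ∧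
    (∀ n, n₀ ≤ n →
      Nat.card ↥(W.selmerLayer κ n) * Nat.card (W.KerG κ n) * Nat.card {m : geomPrimaryTorsion W p | ∀ σ ∈ κ.layerSubgroup n₀, σ • m = m} *
          p ^ (mu f * p ^ n₀ + lam f * n₀) =
        Nat.card ↥(W.selmerLayer κ n₀) * Nat.card (W.KerG κ n₀) * Nat.card {m : geomPrimaryTorsion W p | ∀ σ ∈ κ.layerSubgroup n, σ • m = m} *
          p ^ (mu f * p ^ n + lam f * n)) := by
  refine ⟨?_, fun n hn ↦ ?_⟩
  · rw [← W.natCard_ker_layerToInfty_eq_natCard_fixedPoints κ n₀, ← W.natCard_ker_layerToInfty_eq_natCard_fixedPoints κ (n₀ + 1)]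
    exact (natCard_selmerLayer_succ_mul_eq W κ hγ D hD hnf hchar h0 hΨ).2 hlam
  · rw [← W.natCard_ker_layerToInfty_eq_natCard_fixedPoints κ n₀, ← W.natCard_ker_layerToInfty_eq_natCard_fixedPoints κ n]
    exact natCard_selmerLayer_mul_pow_eq W κ hγ D hD hnf hchar h0 hΨ hlam hn

end Summit.BirchSwinnertonDyer.BirchSwinnertonDyer.Theorems.AlignedTransportAtTwoHalfDescentLayerIndexControl

end
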